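import Summits.Schanuel.Schanuel.Theorems.ZilberEacConicSheetRelation
import Summits.Schanuel.Schanuel.Theorems.ZilberEacHyperellipticSheetCase
import HarnessLib

/-!
# Arbitrary base branches, L (b): EVERY polynomial fibre `y₀ = R(x₀, x₁)` over a CONIC is in
# Mantova–Masser's case AND dense

HONEST FRAMING.  Cell `pub-schanuel` (Zilber's Exponential-Algebraic Closedness, case ladder;
host summit Schanuel), seat 2, gen 30.  Over a conic `C : x₁² = P(x₀)`, `P = x₀² + p₁x₀ + p₀`
monic with simple roots (`c = p₀ − p₁²/4 ≠ 0`), the general polynomial fibre is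
`y₀ = A(x₀) + x₁B(x₀)` (file XLIX).  Along the place `x₁ − x₀ → p₁/2` the exponential points are
`x₀ = 1/s` with `e^{1/s} = A(1/s) + x₁(s)B(1/s) = ψ(s)s^{L}` (`ψ(0) ≠ 0`, `L ∈ ℤ`: the meromorphic
normal form **`exists_sheetFibre_normalForm`**, by the isolated-zeros principle — the fibre value is
not identically zero on `C` because `A² − PB² ≠ 0`), supplied by the pole-fibre labels of file XXXI,
and `y₁ = e^{x₁} = (A + x₁B)(1/s)·e^{p₁/2}·e^{η(s)}` — THEOREM T with two poles (file XLVI).  The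
transcendence of this relation (**`conic_exp_relation_transcendental_sheet`**) is reduced to the
constant-fibre transcendence of file XLIII by the NORM over the two sheets (file XLIX): a relation
`H(x₀, (A + x₁B)θ'e^{η}) = 0` forces `Hn(x₀, θ'e^{η}) = 0` with `Hn ≠ 0`.  Results:
**`unprojectedDensityQuestion_conic_sheetFibre`** — for every `(A, B) ≠ (0, 0)` the surface
`{x₁² − P(x₀) = 0, y₀ = A(x₀) + x₁B(x₀)}` is in Mantova–Masser's case AND has Zariski-dense
exponential points; **`unprojectedDensityQuestion_conic_polyFibre`** — the same for `y₀ = R(x₀, x₁)`,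
`R` any polynomial not vanishing identically on `C`; in particular `y₀ = x₁` over every conic
(**`unprojectedDensityQuestion_conic_fibre_x₁`**) and the unit hyperbola with `y₀ = x₁`,
`y₀ = x₀ + x₁`.  This closes the polynomial fibres over the last pair `(k, deg P) = (2, 2)`.
Decided instances of an OPEN question (Mantova–Masser, PLMS 2024 §1 p. 5); EC(3,2) OPEN; NOT
Schanuel's conjecture (neither used nor implied); EAC ⇏ SC.
-/

noncomputable section

open Filter Topology Set Complex Polynomial
open Literature.NumberTheory.Transcendental Literature.ModelTheory.Zilber
open Literature.ModelTheory.ExponentialFields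

set_option linter.dupNamespace false

namespace Summit.Schanuel.Schanuel.Theorems

/-! ## Part C. Density: every fibre `y₀ = A(x₀) + x₁B(x₀)` over a conic -/

section Conic

variable (P : Polynomial ℂ)

/-- **`y₀ = A(x₀) + x₁B(x₀)` over a conic is dense.**  `P` monic of degree `2` with a simple root,
`(A, B) ≠ (0, 0)`: `{x₁² − P(x₀) = 0, y₀ = A(x₀) + x₁B(x₀)}` has Zariski-dense exponential points.
[cite: MantovaMasser2023, §1 Further remarks, p. 5 (the question, open in general)] (new) -/
theorem unprojectedDense_conic_sheetFibre (A B : Polynomial ℂ) (hAB : A ≠ 0 ∨ B ≠ 0)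
    (hP : P.Monic) (h2 : P.natDegree = 2) {r : ℂ} (hr : P.IsRoot r)
    (hr1 : P.derivative.eval r ≠ 0) :
    UnprojectedDense {w : Fin 2 ⊕ Fin 2 → ℂ |
      MvPolynomial.eval ![w (Sum.inl 0), w (Sum.inl 1)]
          (MvPolynomial.X 1 ^ 2 - Polynomial.aeval (MvPolynomial.X 0 : MvPolynomial (Fin 2) ℂ) P) = 0 ∧
      w (Sum.inr 0) = MvPolynomial.eval ![w (Sum.inl 0), w (Sum.inl 1)]
        (Polynomial.aeval (MvPolynomial.X 0 : MvPolynomial (Fin 2) ℂ) A +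
          MvPolynomial.X 1 * Polynomial.aeval (MvPolynomial.X 0 : MvPolynomial (Fin 2) ℂ) B)} := by
  classical
  obtain ⟨hPeval, hc0⟩ := conic_normalForm P hP h2 hr hr1
  set p₁ : ℂ := P.coeff 1 with hp₁
  set p₀ : ℂ := P.coeff 0 with hp₀
  have hN : A ^ 2 - P * B ^ 2 ≠ 0 := sq_sub_mul_sq_ne_zero P A B hr hr1 hAB
  -- the surface data
  have hirr := irreducible_superellipticMv P (by norm_num : 1 ≤ 2) hr hr1
  have hS := isIrreducibleClosed_curveGraphFibre
    (Polynomial.aeval (MvPolynomial.X 0 : MvPolynomial (Fin 2) ℂ) A +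
      MvPolynomial.X 1 * Polynomial.aeval (MvPolynomial.X 0 : MvPolynomial (Fin 2) ℂ) B) hirr
  have hdim := zariskiDim_curveGraphFibre
    (Polynomial.aeval (MvPolynomial.X 0 : MvPolynomial (Fin 2) ℂ) A +
      MvPolynomial.X 1 * Polynomial.aeval (MvPolynomial.X 0 : MvPolynomial (Fin 2) ℂ) B) hirr
  -- the branch `η` of the conic at infinity and the normal form of the fibre value
  obtain ⟨η, hηan, hη0, hηQ⟩ := exists_conic_branch p₁ (p₀ - p₁ ^ 2 / 4)
  obtain ⟨ψ, L, hψan, hψ0, hf⟩ := exists_sheetFibre_normalForm hηan hηQ hPeval hN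
  -- the labels: `e^{1/s_j} = ψ(s_j)s_j^L`
  obtain ⟨N₀, uu, s, ww, W, -, -, -, -, -, -, hs0, hs, hexp⟩ :=
    exists_poleFibre_expPoints (k := 1) le_rfl L hψan hψ0 (z := 2 * Real.pi * I) (by rw [pow_one])
  have hs' : Tendsto s atTop (𝓝[≠] (0 : ℂ)) :=
    tendsto_nhdsWithin_iff.2 ⟨hs, Eventually.of_forall fun j => hs0 j⟩
  obtain ⟨M₀, hM₀⟩ := Filter.eventually_atTop.1
    (hs'.eventually ((eventually_nhdsWithin_of_eventually_nhds hηQ).and hf))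
  set σ : ℕ → ℂ := fun m => s (M₀ + m) with hσ
  have hσ0 : ∀ m, σ m ≠ 0 := fun m => hs0 _
  have hσt : Tendsto σ atTop (𝓝 0) := hs.comp (tendsto_add_atTop_nat M₀ |>.congr fun m => by omega)
  have hσQ : ∀ m, σ m * η (σ m) ^ 2 + (2 + p₁ * σ m) * η (σ m) - (p₀ - p₁ ^ 2 / 4) * σ m = 0 :=
    fun m => (hM₀ (M₀ + m) (Nat.le_add_right _ _)).1
  have hσf : ∀ m, A.eval (σ m)⁻¹ + ((σ m)⁻¹ + p₁ / 2 + η (σ m)) * B.eval (σ m)⁻¹ =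
      ψ (σ m) * σ m ^ L := fun m => (hM₀ (M₀ + m) (Nat.le_add_right _ _)).2
  have hexpσ : ∀ m, Complex.exp ((σ m)⁻¹) =
      A.eval (σ m)⁻¹ + ((σ m)⁻¹ + p₁ / 2 + η (σ m)) * B.eval (σ m)⁻¹ := by
    intro m
    have h := hexp (M₀ + m)
    rw [pow_one] at h
    rw [hσf]
    exact h
  -- the points
  set θ' : ℂ := Complex.exp (p₁ / 2) with hθ'
  have hθ'0 : θ' ≠ 0 := Complex.exp_ne_zero _
  set pt : ℕ → Fin 2 ⊕ Fin 2 → ℂ := fun m =>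
    Sum.elim ![(σ m)⁻¹, (σ m)⁻¹ + p₁ / 2 + η (σ m)]
      ![A.eval (σ m)⁻¹ + ((σ m)⁻¹ + p₁ / 2 + η (σ m)) * B.eval (σ m)⁻¹,
        Complex.exp ((σ m)⁻¹ + p₁ / 2 + η (σ m))] with hpt
  have hptS : ∀ m, pt m ∈ {w : Fin 2 ⊕ Fin 2 → ℂ |
      MvPolynomial.eval ![w (Sum.inl 0), w (Sum.inl 1)]
          (MvPolynomial.X 1 ^ 2 - Polynomial.aeval (MvPolynomial.X 0 : MvPolynomial (Fin 2) ℂ) P) = 0 ∧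
      w (Sum.inr 0) = MvPolynomial.eval ![w (Sum.inl 0), w (Sum.inl 1)]
        (Polynomial.aeval (MvPolynomial.X 0 : MvPolynomial (Fin 2) ℂ) A +
          MvPolynomial.X 1 * Polynomial.aeval (MvPolynomial.X 0 : MvPolynomial (Fin 2) ℂ) B)} := by
    intro m
    refine ⟨?_, ?_⟩
    · simp only [hpt, Sum.elim_inl, Matrix.cons_val_zero, Matrix.cons_val_one]
      rw [eval_superellipticMv]
      simp only [Matrix.cons_val_zero, Matrix.cons_val_one]
      rw [conic_sheet_sq hPeval (hσ0 m) (hσQ m), sub_self]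
    · simp only [hpt, Sum.elim_inl, Sum.elim_inr, Matrix.cons_val_zero, Matrix.cons_val_one]
      rw [eval_sheetFibreMv]
      simp
  have hpΓ : ∀ m, pt m ∈ expGraph ℂ 2 := by
    intro m
    rw [mem_expGraph_iff]
    intro i
    rw [Literature.ModelTheory.ExponentialFields.ExponentialRing.complex_exp_eq]
    fin_cases i
    · simp [hpt, hexpσ m]
    · simp [hpt]
  have hnorm : Tendsto (fun m => ‖pt m (Sum.inl 0)‖) atTop atTop := by
    have hσ' : Tendsto σ atTop (𝓝[≠] (0 : ℂ)) :=
      tendsto_nhdsWithin_iff.2 ⟨hσt, Eventually.of_forall fun m => hσ0 m⟩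
    have h := (tendsto_norm_inv_nhdsNE_zero_atTop (α := ℂ)).comp hσ'
    refine h.congr fun m => ?_
    simp [hpt]
  -- the relation `y₁ = w(σ)σ⁻¹^d`, `w(u) = ψ(u)u^{L⁺}θ'e^{η(u)}`, `d = L⁻`
  set d : ℕ := (-L).toNat with hd
  set w : ℂ → ℂ := fun u => ψ u * u ^ L.toNat * (θ' * Complex.exp (η u)) with hw
  have hwan : AnalyticAt ℂ w 0 :=
    (hψan.mul (analyticAt_id.pow _)).mul (analyticAt_const.mul hηan.cexp)
  have hzpow : ∀ u : ℂ, u ≠ 0 → u ^ L = u ^ L.toNat * u⁻¹ ^ d := by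
    intro u hu
    conv_lhs => rw [← Int.toNat_sub_toNat_neg L]
    rw [zpow_sub₀ hu, zpow_natCast, zpow_natCast, hd, inv_pow, div_eq_mul_inv]
  have hx : ∀ m, pt m (Sum.inl 0) = (fun _ : ℂ => (1 : ℂ)) (σ m) * (σ m)⁻¹ ^ 1 := by
    intro m; simp [hpt]
  have hy : ∀ m, pt m (Sum.inr 1) = w (σ m) * (σ m)⁻¹ ^ d := by
    intro m
    simp only [hpt, hw, Sum.elim_inr, Matrix.cons_val_one, Matrix.cons_val_fin_one]
    rw [Complex.exp_add, Complex.exp_add, hexpσ m, hσf m, hθ', hzpow _ (hσ0 m)]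
    ring
  have htr : ∀ H : ℂ[X][X], H ≠ 0 →
      ¬ (∀ᶠ u in 𝓝[≠] (0 : ℂ), (H.map (Polynomial.evalRingHom
        ((fun _ : ℂ => (1 : ℂ)) u * u⁻¹ ^ 1))).eval (w u * u⁻¹ ^ d) = 0) := by
    intro H hH0 hev
    refine conic_exp_relation_transcendental_sheet hc0 hθ'0 hηan hη0 hηQ hPeval hN H hH0 ?_
    filter_upwards [hev, hf, self_mem_nhdsWithin] with u hu hfu hu0
    have hu0' : u ≠ 0 := hu0
    have e1 : (fun _ : ℂ => (1 : ℂ)) u * u⁻¹ ^ 1 = u⁻¹ := by simp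
    have e2 : w u * u⁻¹ ^ d =
        (A.eval u⁻¹ + (u⁻¹ + p₁ / 2 + η u) * B.eval u⁻¹) * (θ' * Complex.exp (η u)) := by
      rw [hfu, hzpow u hu0', hw]
      ring
    rw [e1, e2] at hu
    exact hu
  exact unprojectedDense_of_transcendental_relation_pole₂ hS (le_of_eq hdim) 0 1 hptS hpΓ hnorm
    analyticAt_const hwan 1 d hσ0 hσt hx hy htr

/-! ## Part D. Mantova–Masser's case and the packaged statements -/

/-- **Mantova–Masser's question for `y₀ = A(x₀) + x₁B(x₀)` over a conic: case ∧ dense**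
(`P` monic of degree `2` with a simple root; `(A, B) ≠ (0, 0)`).
[cite: MantovaMasser2023, §1 Further remarks, p. 5 (the question, open in general)] (new) -/
theorem unprojectedDensityQuestion_conic_sheetFibre (A B : Polynomial ℂ) (hAB : A ≠ 0 ∨ B ≠ 0)
    (hP : P.Monic) (h2 : P.natDegree = 2) {r : ℂ} (hr : P.IsRoot r)
    (hr1 : P.derivative.eval r ≠ 0) :
    MMCaseDimPiOneFree {w : Fin 2 ⊕ Fin 2 → ℂ |
        MvPolynomial.eval ![w (Sum.inl 0), w (Sum.inl 1)]
            (MvPolynomial.X 1 ^ 2 - Polynomial.aeval (MvPolynomial.X 0 : MvPolynomial (Fin 2) ℂ) P) = 0 ∧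
        w (Sum.inr 0) = MvPolynomial.eval ![w (Sum.inl 0), w (Sum.inl 1)]
          (Polynomial.aeval (MvPolynomial.X 0 : MvPolynomial (Fin 2) ℂ) A +
            MvPolynomial.X 1 * Polynomial.aeval (MvPolynomial.X 0 : MvPolynomial (Fin 2) ℂ) B)} ∧
      UnprojectedDense {w : Fin 2 ⊕ Fin 2 → ℂ |
        MvPolynomial.eval ![w (Sum.inl 0), w (Sum.inl 1)]
            (MvPolynomial.X 1 ^ 2 - Polynomial.aeval (MvPolynomial.X 0 : MvPolynomial (Fin 2) ℂ) P) = 0 ∧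
        w (Sum.inr 0) = MvPolynomial.eval ![w (Sum.inl 0), w (Sum.inl 1)]
          (Polynomial.aeval (MvPolynomial.X 0 : MvPolynomial (Fin 2) ℂ) A +
            MvPolynomial.X 1 * Polynomial.aeval (MvPolynomial.X 0 : MvPolynomial (Fin 2) ℂ) B)} :=
  ⟨mmCase_hyperelliptic_sheetFibre P A B hAB hr hr1,
    unprojectedDense_conic_sheetFibre P A B hAB hP h2 hr hr1⟩

/-- **EVERY polynomial fibre over a conic: case ∧ dense.**  `P` monic of degree `2` with a simple
root, `R ∈ ℂ[x₀, x₁]` not vanishing identically on the conic: `{x₁² − P(x₀) = 0, y₀ = R(x₀, x₁)}`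
is in Mantova–Masser's case AND has Zariski-dense exponential points.
[cite: MantovaMasser2023, §1 Further remarks, p. 5 (the question, open in general)] (new) -/
theorem unprojectedDensityQuestion_conic_polyFibre (R : MvPolynomial (Fin 2) ℂ)
    (hR : ∃ x : Fin 2 → ℂ, MvPolynomial.eval x
        (MvPolynomial.X 1 ^ 2 - Polynomial.aeval (MvPolynomial.X 0 : MvPolynomial (Fin 2) ℂ) P) = 0 ∧
      MvPolynomial.eval x R ≠ 0)
    (hP : P.Monic) (h2 : P.natDegree = 2) {r : ℂ} (hr : P.IsRoot r)
    (hr1 : P.derivative.eval r ≠ 0) :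
    MMCaseDimPiOneFree {w : Fin 2 ⊕ Fin 2 → ℂ |
        MvPolynomial.eval ![w (Sum.inl 0), w (Sum.inl 1)]
            (MvPolynomial.X 1 ^ 2 - Polynomial.aeval (MvPolynomial.X 0 : MvPolynomial (Fin 2) ℂ) P) = 0 ∧
        w (Sum.inr 0) = MvPolynomial.eval ![w (Sum.inl 0), w (Sum.inl 1)] R} ∧
      UnprojectedDense {w : Fin 2 ⊕ Fin 2 → ℂ |
        MvPolynomial.eval ![w (Sum.inl 0), w (Sum.inl 1)]
            (MvPolynomial.X 1 ^ 2 - Polynomial.aeval (MvPolynomial.X 0 : MvPolynomial (Fin 2) ℂ) P) = 0 ∧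
        w (Sum.inr 0) = MvPolynomial.eval ![w (Sum.inl 0), w (Sum.inl 1)] R} := by
  obtain ⟨A, B, Q, hRAB⟩ := exists_hyperelliptic_reduction P R
  rw [curveGraphFibre_eq_of_reduction P A B R Q hRAB]
  exact unprojectedDensityQuestion_conic_sheetFibre P A B (reduction_ne_zero P A B R Q hRAB hR) hP h2
    hr hr1

/-- **Plain coordinates**: `{x₁² − P(x₀) = 0, y₀ = A(x₀) + x₁B(x₀)}` is in the case AND dense
(hypotheses as above). [cite: MantovaMasser2023, §1 Further remarks, p. 5 (the question, open in
general)] (new) -/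
theorem unprojectedDensityQuestion_conic_sheetFibre' (A B : Polynomial ℂ) (hAB : A ≠ 0 ∨ B ≠ 0)
    (hP : P.Monic) (h2 : P.natDegree = 2) {r : ℂ} (hr : P.IsRoot r)
    (hr1 : P.derivative.eval r ≠ 0) :
    MMCaseDimPiOneFree {w : Fin 2 ⊕ Fin 2 → ℂ |
        w (Sum.inl 1) ^ 2 - P.eval (w (Sum.inl 0)) = 0 ∧
        w (Sum.inr 0) = A.eval (w (Sum.inl 0)) + w (Sum.inl 1) * B.eval (w (Sum.inl 0))} ∧
      UnprojectedDense {w : Fin 2 ⊕ Fin 2 → ℂ |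
        w (Sum.inl 1) ^ 2 - P.eval (w (Sum.inl 0)) = 0 ∧
        w (Sum.inr 0) = A.eval (w (Sum.inl 0)) + w (Sum.inl 1) * B.eval (w (Sum.inl 0))} := by
  rw [← sheetFibre_setOf_eq]
  exact unprojectedDensityQuestion_conic_sheetFibre P A B hAB hP h2 hr hr1

/-- **`y₀ = x₁` over every conic: case ∧ dense** (`P` monic of degree `2` with a simple root).
[cite: MantovaMasser2023, §1 Further remarks, p. 5 (the question, open in general)] (new) -/
theorem unprojectedDensityQuestion_conic_fibre_x₁ (hP : P.Monic) (h2 : P.natDegree = 2) {r : ℂ}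
    (hr : P.IsRoot r) (hr1 : P.derivative.eval r ≠ 0) :
    MMCaseDimPiOneFree {w : Fin 2 ⊕ Fin 2 → ℂ |
        w (Sum.inl 1) ^ 2 - P.eval (w (Sum.inl 0)) = 0 ∧ w (Sum.inr 0) = w (Sum.inl 1)} ∧
      UnprojectedDense {w : Fin 2 ⊕ Fin 2 → ℂ |
        w (Sum.inl 1) ^ 2 - P.eval (w (Sum.inl 0)) = 0 ∧ w (Sum.inr 0) = w (Sum.inl 1)} := by
  have e : {w : Fin 2 ⊕ Fin 2 → ℂ |
        w (Sum.inl 1) ^ 2 - P.eval (w (Sum.inl 0)) = 0 ∧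
        w (Sum.inr 0) = (0 : ℂ[X]).eval (w (Sum.inl 0)) + w (Sum.inl 1) * (1 : ℂ[X]).eval (w (Sum.inl 0))} =
      {w : Fin 2 ⊕ Fin 2 → ℂ |
        w (Sum.inl 1) ^ 2 - P.eval (w (Sum.inl 0)) = 0 ∧ w (Sum.inr 0) = w (Sum.inl 1)} := by
    ext w
    simp only [Set.mem_setOf_eq, Polynomial.eval_zero, Polynomial.eval_one, zero_add, mul_one]
  have h := unprojectedDensityQuestion_conic_sheetFibre' P 0 1 (Or.inr one_ne_zero) hP h2 hr hr1
  rw [e] at h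
  exact h

end Conic

/-! ## Part E. Examples: the unit hyperbola `x₁² = x₀² + 1` -/

/-- The unit hyperbola data: `x² + 1` is monic of degree `2` with the simple root `i`. -/
theorem unitHyperbola_data :
    (Polynomial.X ^ 2 + 1 : ℂ[X]).Monic ∧ (Polynomial.X ^ 2 + 1 : ℂ[X]).natDegree = 2 ∧
      (Polynomial.X ^ 2 + 1 : ℂ[X]).IsRoot I ∧
      (Polynomial.derivative (Polynomial.X ^ 2 + 1 : ℂ[X])).eval I ≠ 0 := by
  refine ⟨?_, ?_, ?_, ?_⟩
  · simpa using Polynomial.monic_X_pow_add_C (1 : ℂ) (by norm_num : (2 : ℕ) ≠ 0)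
  · simpa using Polynomial.natDegree_X_pow_add_C (n := 2) (r := (1 : ℂ))
  · simp [Polynomial.IsRoot, Complex.I_sq]
  · rw [Polynomial.derivative_add, Polynomial.derivative_one, Polynomial.derivative_X_pow, add_zero,
      Polynomial.eval_mul, Polynomial.eval_C, Polynomial.eval_pow, Polynomial.eval_X]
    simp [Complex.I_ne_zero]

/-- Example: `{x₁² = x₀² + 1, y₀ = x₁}`: case ∧ dense.
[cite: MantovaMasser2023, §1 Further remarks, p. 5 (the question, open in general)] (new) -/
theorem unprojectedDensityQuestion_unitHyperbola_fibre_x₁ :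
    MMCaseDimPiOneFree {w : Fin 2 ⊕ Fin 2 → ℂ |
        w (Sum.inl 1) ^ 2 - (Polynomial.X ^ 2 + 1 : ℂ[X]).eval (w (Sum.inl 0)) = 0 ∧
        w (Sum.inr 0) = w (Sum.inl 1)} ∧
      UnprojectedDense {w : Fin 2 ⊕ Fin 2 → ℂ |
        w (Sum.inl 1) ^ 2 - (Polynomial.X ^ 2 + 1 : ℂ[X]).eval (w (Sum.inl 0)) = 0 ∧
        w (Sum.inr 0) = w (Sum.inl 1)} := by
  obtain ⟨hm, hd, hr, hr1⟩ := unitHyperbola_data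
  exact unprojectedDensityQuestion_conic_fibre_x₁ _ hm hd hr hr1

/-- Example: `{x₁² = x₀² + 1, y₀ = x₀ + x₁}` (the fibre value is the rational coordinate
`x₀ + x₁ = 1/(x₁ − x₀)` of the hyperbola): case ∧ dense.
[cite: MantovaMasser2023, §1 Further remarks, p. 5 (the question, open in general)] (new) -/
theorem unprojectedDensityQuestion_unitHyperbola_fibre_x₀_add_x₁ :
    MMCaseDimPiOneFree {w : Fin 2 ⊕ Fin 2 → ℂ |
        w (Sum.inl 1) ^ 2 - (Polynomial.X ^ 2 + 1 : ℂ[X]).eval (w (Sum.inl 0)) = 0 ∧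
        w (Sum.inr 0) = w (Sum.inl 0) + w (Sum.inl 1)} ∧
      UnprojectedDense {w : Fin 2 ⊕ Fin 2 → ℂ |
        w (Sum.inl 1) ^ 2 - (Polynomial.X ^ 2 + 1 : ℂ[X]).eval (w (Sum.inl 0)) = 0 ∧
        w (Sum.inr 0) = w (Sum.inl 0) + w (Sum.inl 1)} := by
  obtain ⟨hm, hd, hr, hr1⟩ := unitHyperbola_data
  have e : {w : Fin 2 ⊕ Fin 2 → ℂ |
        w (Sum.inl 1) ^ 2 - (Polynomial.X ^ 2 + 1 : ℂ[X]).eval (w (Sum.inl 0)) = 0 ∧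
        w (Sum.inr 0) = (Polynomial.X : ℂ[X]).eval (w (Sum.inl 0)) +
          w (Sum.inl 1) * (1 : ℂ[X]).eval (w (Sum.inl 0))} =
      {w : Fin 2 ⊕ Fin 2 → ℂ |
        w (Sum.inl 1) ^ 2 - (Polynomial.X ^ 2 + 1 : ℂ[X]).eval (w (Sum.inl 0)) = 0 ∧
        w (Sum.inr 0) = w (Sum.inl 0) + w (Sum.inl 1)} := by
    ext w
    simp only [Set.mem_setOf_eq, Polynomial.eval_X, Polynomial.eval_one, mul_one]
  have h := unprojectedDensityQuestion_conic_sheetFibre' _ Polynomial.X 1 (Or.inr one_ne_zero)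
    hm hd hr hr1
  rw [e] at h
  exact h

end Summit.Schanuel.Schanuel.Theorems

end
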